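import Summits.QuantumFields.YangMills.Theorems.BalabanUVNodesN21ThresholdMixtureRStepLocalityRaw
import Literature.MathematicalPhysics.QuantumFieldTheory.Balaban1983to89.Node00.BackgroundFamilyOfRecord

/-!
# N21 (NE7c), strategy s3 «alternative currency», file 28 — KT-28's (LOC) AS A THEOREM AT def-R's NORMALISED FAMILY `𝔟ᴺ`: the OFF part of the sequence's
# front factor `χ_k(Ω_k)` read through FILE 19's `chiSeqOfRecordBg` at `𝔟ᴺ := fun K k => normalise (bgFamOfRecord F N ν K k) (plaqDetermined_plaqSmall _)`
# is FIBRE-INDEPENDENT of every fibre missing the OFF cubes' local read sets — UNCONDITIONALLY ((LOC) = r11, PROVED; (DISJ) displayed) —, and the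
# identification with the record's RAW χ is ONE-SIDED: `χᴺ ≤ χ_record` under [15]-uniqueness (equality on solvable cubes, junk-`1` on the others)

HEADER — WORK-UNIT METADATA.  Seat `pub-ymgap-dag-n21-e` (R141 (C) fan-out, node N21 = NE7c, strategy s3 = ALTERNATIVE CURRENCY), g9, file 28; answers node00-def-R
g18's ANSWER-N21E-LOCATED-RAW-Γ₀ (bus l.19329: «record χ RAW (freeze); locality currency = NORMALISE via FILE 19 `chiOfRecordBg ∕ chiSeqOfRecordBg` at `𝔟ᴺ`, zero
new bytes; (H-U) cost of `𝔟ᴺ` flagged; H0») and its question (G) «does NE7c's road need locality of the record's own χ or of a currency n21-e chooses?» —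
THIS SEAT STATES THE ROAD AT `𝔟ᴺ` (bus l.19373).  Lane: `--kind proof --supports stmt-QuantumFields-20296 --as helper` (K3⁵ `SpineGivenEndpointR13SepCoP`).  Count-neutral.

THE CONTENT.  `𝔟ᴺ K k := normalise (bgFamOfRecord F N ν K k) (plaqDetermined_plaqSmall _)` (written as this lambda throughout; no definition — def-R's
desk recipe `ChiNRecipe-g18.lean` letters): the interior-local normalisation (r11 `B14.Eq12InteriorLocality.normalise`) of the record's (2.12) datum, SAME
class, SAME solvable domain, a minimiser wherever the record's map is one (`isMinimizer_normalise`).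
(N1) `fibreIndep_recordStatN` — 22c's `fibreIndep_supStat_ukBox_normalise` AT `𝔟ᴺ K k`: the block-sup statistic of cube `a` over `plaqInside (□_a^∼)` read through
     `ukBox (𝔟ᴺ K k) ν.M₁ □_a^{≈4} k` is fibre-independent of every fibre missing `liftIter k (inputs (near 𝐁_k(□_a^{≈4})))`, under the cube-geometry side
     condition `hgeom` (the tested plaquettes avoid the far `Γ₀`-bonds — [Balaban1988Convergent] pp. 255–257, displayed); (N1′) the χ-slot at any threshold and
     polarity (`fibreIndep_chiSlotN`).
(N2) `chiSeqOfRecordBg_eq_prod_smallInd` ∕ `chiSeqOfRecordBg_eq_off_mul_on` (generic in the family `𝔟`): FILE 19's `χ_k(Ω_k)` over a family = the product of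
     `smallInd (block-sup statistic) (ε_kη_k²)` over the cubes of `Ω_k(s)` (13a `chiSmall_eq_smallInd_iSup`), split OFF × ON along any cube set `On`.
(N3) ★★ `fibreIndep_chiSeqN_off` — KT-28 AT `𝔟ᴺ`, A THEOREM: for every fibre `fib`, every threshold vector `S` and polarity vector `pol` (the mixture road's
     common-box letters), the product over the OFF cubes of `Ω_k(s)` — those whose local read set misses `fib` (`hoff`, (DISJ) displayed: def-R's `fibOfSeq`
     geometry decides `On`) — of `(pol c).fac (smallInd (statᴺ c V) (S c))` is `FibreIndep fib`; (N3′) `fibreIndep_chiSeqN_offFactor`: the OFF factor of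
     `chiSeqOfRecordBg F N 𝔟ᴺ …` itself (pol = small, `S ≡ ε_kη_k²`).  This is 22b's `fibreIndep_chi218_off_of_localPlaq` with `hlocP` DISCHARGED — files
     20∕21∕23's `hc`∕`hc'`∕`huI`∕`hoff` binders at the `𝔟ᴺ` currency are theorems modulo (DISJ) + `hgeom`.
(N4) THE IDENTIFICATION RESIDUAL, ONE-SIDED (`chiSlotN_eq_chiSlot_of_solvable_of_huniq`, `chiSlotN_le_chiSlot_of_huniq`, ★ `chiSeqN_le_chiSeqOfRecord_of_huniq`):
     on a cube whose (2.16) datum is SOLVABLE both `ukBox (𝔟ᴺ K k)` and the record's `ukBox (bgFamOfRecord …)` are (2.12) minimisers for it, so under the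
     displayed plaquette-uniqueness `huniq` ([15] Thm 1's consequence on the tested plaquettes, NOT asserted) their χ-slots AGREE; on an unsolvable cube the
     record's slot is junk-`1` (n20-d `chiSmall_ukBox_eq_one_of_not_solvable`; file 26: every far-large configuration) and dominates.  Hence
     `chiSeqOfRecordBg F N 𝔟ᴺ … ≤ chiSeqOfRecord …` pointwise under `huniq`, with equality where every cube of `Ω_k(s)` is solvable — the exact bridge def-R §D
     names («`huniq` near + NOTHING far»); only a record re-point (def-R §F, K0c's measurable local selector) removes the inequality.

HONEST FRAMING.  NE7c is NOT PRINTED and NOT PROVED.  [folklore] bookkeeping over r11 ∕ def-R ∕ 22b∕22c letters; `𝔟ᴺ` has NO (H-U) measurability proof in the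
tree (def-R g18: `rep` = ε-choice) — every measure-level consumer of (N3) at `𝔟ᴺ` carries (H-U) as a displayed binder; `huniq` ∕ solvability displayed, [15]
NOT asserted; the record's χ stays RAW (edition freeze №160 (4)); nothing of Bałaban's asserted; N21 NOT discharged; counts UNMOVED; count-neutral; one finite
𝕋⁴ at fixed `ε`; NOT ℝ⁴ ∕ OS ∕ mass gap ∕ Clay.

CITATION HEADER (lean-in-tree rule 2026-08-18).  BY NAME: def-R FILE 19 `Node00.BgFam` ∕ `bgFamOfRecord` ∕ `chiSeqOfRecordBg` ∕ `chiSeqOfRecordBg_apply` ∕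
`chiSeqOfRecordBg_bgFam`; r11 `B14.Eq12InteriorLocality.normalise` ∕ `isMinimizer_normalise` ∕ `plaqDetermined_plaqSmall` ∕ `plaqBonds` ∕ `farBonds` ∕ `near`;
`B14.Eq216Concrete.ukBox` ∕ `liftIter` ∕ `inputs`; `B14.Eq218Concrete.cubesIn` ∕ `chiSmall_nonneg` ∕ `chiSmall_le_one`; 22c `fibreIndep_supStat_ukBox_normalise`;
21 `fibreIndep_prod_fac_smallInd`; 13a `chiSmall_eq_smallInd_iSup`; n20-d `N20ChiSemantics.chiSmall_ukBox_eq_one_of_not_solvable`; `T4LipschitzLedger.Pol` ∕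
`T4IndicatorShell.smallInd`; `T4DressedR.FibreIndep`.  Context only (SHAPE, nothing asserted): [Balaban1988Convergent] (2.12) p. 256, (2.16)–(2.18) p. 257;
[Balaban1989LargeFieldI] (0.3) p. 176.

WHAT IS PROVED ([folklore]).  (N1) ★ `fibreIndep_recordStatN` · `fibreIndep_chiSlotN`; (N2) `chiSeqOfRecordBg_eq_prod_smallInd` · `chiSeqOfRecordBg_eq_off_mul_on`;
(N3) ★★ `fibreIndep_chiSeqN_off` · `fibreIndep_chiSeqN_offFactor`; (N4) `chiSlotN_eq_chiSlot_of_solvable_of_huniq` · `chiSlotN_le_chiSlot_of_huniq` ·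
★ `chiSeqN_le_chiSeqOfRecord_of_huniq`.
-/

set_option autoImplicit false

noncomputable section

open Set
open scoped BigOperators

namespace Summit.QuantumFields.YangMills.Theorems.N21ThresholdMixtureRStepLocalityBgN

open Literature.MathematicalPhysics.QuantumFieldTheory.Balaban1983to89
open Literature.MathematicalPhysics.QuantumFieldTheory.Balaban1983to89.Node00
open T4Continuum B15DeterminingSets B14.Eq213DetSet B14.Eq216Concrete B14.Eq12InteriorLocality B14.Eq213MaximalDomains B15Eq112TorusCover
  B14DomainGeom B14.Eq218Concrete
open Literature.MathematicalPhysics.QuantumFieldTheory.Balaban1983to89.T4DressedR (FibreIndep)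
open Literature.MathematicalPhysics.QuantumFieldTheory.Balaban1983to89.T4IndicatorShell (smallInd)
open Literature.MathematicalPhysics.QuantumFieldTheory.Balaban1983to89.T4LipschitzLedger (Pol)
open Summit.QuantumFields.YangMills.Theorems.N21ThresholdMixtureRecordChi (chiSmall_eq_smallInd_iSup)
open Summit.QuantumFields.YangMills.Theorems.N21ThresholdMixtureRStepCommonBox (fibreIndep_prod_fac_smallInd)
open Summit.QuantumFields.YangMills.Theorems.N21ThresholdMixtureRStepLocalityNormalise (fibreIndep_supStat_ukBox_normalise)
open Literature.MathematicalPhysics.QuantumFieldTheory.BalabanImbrieJaffe1984to88.BIJ85Eq453GaugeField (qsstarGIter0)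
open Summit.QuantumFields.YangMills.BalabanUVNodes.N20ChiSemantics (chiSmall_ukBox_eq_one_of_not_solvable isMinimizer_ukBox_of_solvable)

variable (F : T4Family) (N : ℕ) [NeZero N]

/-! ## (N1) The block-sup statistic and the χ-slot of one cube at `𝔟ᴺ` are fibre-independent OFF the cube's local read set -/

/-- ★ (N1) **22c AT `𝔟ᴺ K k`**: the block-sup statistic of cube `a` read through the NORMALISED datum of record is fibre-independent of every fibre missing the
local read set `liftIter k (inputs (near 𝐁_k(□_a^{≈4})))` — (LOC) PROVED (r11), (DISJ) = `hdisj`, cube geometry = `hgeom` (displayed).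
[cite: Balaban1988Convergent, (2.12) p.256, (2.16)–(2.17) p.257] -/
theorem fibreIndep_recordStatN (ν : Stage7Numerics) (g : ℕ → ℝ) (K k : ℕ) [DecidableEq (PBond (F.P K) k)] (hk : k ≤ (F.P K).m + (F.P K).K)
    (a : ↥(cubeIndices (F.P K) (cubeSide (F.P K).L ν.M₂ (RkOfRecord (F.P K).L ν.r (g k)) k)))
    (hgeom : ∀ p ∈ plaqInside (cubeEnl (F.P K) (cubeSide (F.P K).L ν.M₂ (RkOfRecord (F.P K).L ν.r (g k)) k) a 1), ∀ b ∈ plaqBonds p,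
      b ∉ farBonds (Bj ν.M₁ (cubeEnl (F.P K) (cubeSide (F.P K).L ν.M₂ (RkOfRecord (F.P K).L ν.r (g k)) k) a 4) k))
    (fib : Finset (PBond (F.P K) k))
    (hdisj : ∀ c ∈ liftIter k (inputs (near (Bj ν.M₁ (cubeEnl (F.P K) (cubeSide (F.P K).L ν.M₂ (RkOfRecord (F.P K).L ν.r (g k)) k) a 4) k))), c ∉ fib) :
    FibreIndep fib fun V : GaugeField (F.P K) k (SU N) =>
      ⨆ p : ↥(plaqInside (cubeEnl (F.P K) (cubeSide (F.P K).L ν.M₂ (RkOfRecord (F.P K).L ν.r (g k)) k) a 1)),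
        dist1 (GaugeField.plaqHol (ukBox (normalise (bgFamOfRecord F N ν K k) (plaqDetermined_plaqSmall _)) ν.M₁
          (cubeEnl (F.P K) (cubeSide (F.P K).L ν.M₂ (RkOfRecord (F.P K).L ν.r (g k)) k) a 4) k V) p.1) :=
  fibreIndep_supStat_ukBox_normalise (bgFamOfRecord F N ν K k) ν.M₁ (plaqDetermined_plaqSmall _) hk _ hgeom fib hdisj

/-- (N1′) … hence so is the cube's χ-slot factor at ANY threshold `S` and polarity `pol` (the mixture road's common-box letters).
[cite: Balaban1988Convergent, (2.17) p.257] -/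
theorem fibreIndep_chiSlotN (ν : Stage7Numerics) (g : ℕ → ℝ) (K k : ℕ) [DecidableEq (PBond (F.P K) k)] (hk : k ≤ (F.P K).m + (F.P K).K)
    (a : ↥(cubeIndices (F.P K) (cubeSide (F.P K).L ν.M₂ (RkOfRecord (F.P K).L ν.r (g k)) k)))
    (hgeom : ∀ p ∈ plaqInside (cubeEnl (F.P K) (cubeSide (F.P K).L ν.M₂ (RkOfRecord (F.P K).L ν.r (g k)) k) a 1), ∀ b ∈ plaqBonds p,
      b ∉ farBonds (Bj ν.M₁ (cubeEnl (F.P K) (cubeSide (F.P K).L ν.M₂ (RkOfRecord (F.P K).L ν.r (g k)) k) a 4) k))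
    (fib : Finset (PBond (F.P K) k))
    (hdisj : ∀ c ∈ liftIter k (inputs (near (Bj ν.M₁ (cubeEnl (F.P K) (cubeSide (F.P K).L ν.M₂ (RkOfRecord (F.P K).L ν.r (g k)) k) a 4) k))), c ∉ fib)
    (pol : Pol) (S : ℝ) :
    FibreIndep fib fun V : GaugeField (F.P K) k (SU N) =>
      pol.fac (smallInd (⨆ p : ↥(plaqInside (cubeEnl (F.P K) (cubeSide (F.P K).L ν.M₂ (RkOfRecord (F.P K).L ν.r (g k)) k) a 1)),
        dist1 (GaugeField.plaqHol (ukBox (normalise (bgFamOfRecord F N ν K k) (plaqDetermined_plaqSmall _)) ν.M₁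
          (cubeEnl (F.P K) (cubeSide (F.P K).L ν.M₂ (RkOfRecord (F.P K).L ν.r (g k)) k) a 4) k V) p.1)) S) :=
  fun V y => by
    have h := fibreIndep_recordStatN F N ν g K k hk a hgeom fib hdisj V y
    dsimp only at h ⊢
    rw [h]

/-! ## (N2) FILE 19's `χ_k(Ω_k)` over ANY family as a product of sharp indicators; the OFF × ON split -/

/-- (N2) `χ_k(Ω_k)` over a datum family `𝔟` = the product over the cubes of `Ω_k(s)` of `smallInd (block-sup statistic) (ε_kη_k²)` (FILE 19
`chiSeqOfRecordBg_apply` + 13a `chiSmall_eq_smallInd_iSup`). [cite: Balaban1988Convergent, (2.17) p.257] -/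
theorem chiSeqOfRecordBg_eq_prod_smallInd (𝔟 : BgFam F N) (ν : Stage7Numerics) (M : ℕ) (g : ℕ → ℝ) (K k : ℕ)
    (hε : 0 < epsOfRecord ν g k * (F.P K).eta k ^ 2) (s : SeqOfRecord F ν M g K k) (V : GaugeField (F.P K) k (SU N)) :
    chiSeqOfRecordBg F N 𝔟 ν M g K k s V =
      ∏ a ∈ cubesIn (fun a : ↥(cubeIndices (F.P K) (cubeSide (F.P K).L ν.M₂ (RkOfRecord (F.P K).L ν.r (g k)) k)) =>
          cubeEnl (F.P K) (cubeSide (F.P K).L ν.M₂ (RkOfRecord (F.P K).L ν.r (g k)) k) a 0) (s.Ω k),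
        smallInd (⨆ p : ↥(plaqInside (cubeEnl (F.P K) (cubeSide (F.P K).L ν.M₂ (RkOfRecord (F.P K).L ν.r (g k)) k) a 1)),
          dist1 (GaugeField.plaqHol (ukBox (𝔟 K k) ν.M₁ (cubeEnl (F.P K) (cubeSide (F.P K).L ν.M₂ (RkOfRecord (F.P K).L ν.r (g k)) k) a 4) k V) p.1))
          (epsOfRecord ν g k * (F.P K).eta k ^ 2) := by
  rw [chiSeqOfRecordBg_apply]
  exact Finset.prod_congr rfl fun a _ => chiSmall_eq_smallInd_iSup (Or.inr hε) _

/-- (N2′) … split OFF × ON along any cube set `On` (`Finset.prod_filter_mul_prod_filter_not`). [cite: Balaban1988Convergent, (2.17)–(2.18) p.257; Balaban1989LargeFieldI, (0.3) p.176] -/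
theorem chiSeqOfRecordBg_eq_off_mul_on (𝔟 : BgFam F N) (ν : Stage7Numerics) (M : ℕ) (g : ℕ → ℝ) (K k : ℕ)
    (hε : 0 < epsOfRecord ν g k * (F.P K).eta k ^ 2) (s : SeqOfRecord F ν M g K k)
    (On : Finset ↥(cubeIndices (F.P K) (cubeSide (F.P K).L ν.M₂ (RkOfRecord (F.P K).L ν.r (g k)) k))) (V : GaugeField (F.P K) k (SU N)) :
    chiSeqOfRecordBg F N 𝔟 ν M g K k s V =
      (∏ a ∈ (cubesIn (fun a : ↥(cubeIndices (F.P K) (cubeSide (F.P K).L ν.M₂ (RkOfRecord (F.P K).L ν.r (g k)) k)) =>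
          cubeEnl (F.P K) (cubeSide (F.P K).L ν.M₂ (RkOfRecord (F.P K).L ν.r (g k)) k) a 0) (s.Ω k)).filter (fun a => a ∉ On),
        smallInd (⨆ p : ↥(plaqInside (cubeEnl (F.P K) (cubeSide (F.P K).L ν.M₂ (RkOfRecord (F.P K).L ν.r (g k)) k) a 1)),
          dist1 (GaugeField.plaqHol (ukBox (𝔟 K k) ν.M₁ (cubeEnl (F.P K) (cubeSide (F.P K).L ν.M₂ (RkOfRecord (F.P K).L ν.r (g k)) k) a 4) k V) p.1))
          (epsOfRecord ν g k * (F.P K).eta k ^ 2)) *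
      ∏ a ∈ (cubesIn (fun a : ↥(cubeIndices (F.P K) (cubeSide (F.P K).L ν.M₂ (RkOfRecord (F.P K).L ν.r (g k)) k)) =>
          cubeEnl (F.P K) (cubeSide (F.P K).L ν.M₂ (RkOfRecord (F.P K).L ν.r (g k)) k) a 0) (s.Ω k)).filter (fun a => ¬ a ∉ On),
        smallInd (⨆ p : ↥(plaqInside (cubeEnl (F.P K) (cubeSide (F.P K).L ν.M₂ (RkOfRecord (F.P K).L ν.r (g k)) k) a 1)),
          dist1 (GaugeField.plaqHol (ukBox (𝔟 K k) ν.M₁ (cubeEnl (F.P K) (cubeSide (F.P K).L ν.M₂ (RkOfRecord (F.P K).L ν.r (g k)) k) a 4) k V) p.1))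
          (epsOfRecord ν g k * (F.P K).eta k ^ 2) := by
  rw [chiSeqOfRecordBg_eq_prod_smallInd F N 𝔟 ν M g K k hε s V, Finset.prod_filter_mul_prod_filter_not]

/-! ## (N3) KT-28 at `𝔟ᴺ`, a THEOREM: the OFF product is fibre-independent -/

/-- ★★ (N3) **KT-28's (LOC) AS A THEOREM AT `𝔟ᴺ`**: for every fibre `fib`, threshold vector `S` and polarity vector `pol`, the product over the OFF cubes of
`Ω_k(s)` — those `c ∉ On` whose local read set misses `fib` (`hoff`) — of `(pol c).fac (smallInd (statᴺ c) (S c))` is fibre-independent of `fib`.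
22b's `fibreIndep_chi218_off_of_localPlaq` with `hlocP` DISCHARGED by (N1). [cite: Balaban1988Convergent, (2.16)–(2.18) p.257; Balaban1989LargeFieldI, (0.3) p.176] -/
theorem fibreIndep_chiSeqN_off (ν : Stage7Numerics) (g : ℕ → ℝ) (K k : ℕ) [DecidableEq (PBond (F.P K) k)] (hk : k ≤ (F.P K).m + (F.P K).K)
    (hgeom : ∀ (c : ↥(cubeIndices (F.P K) (cubeSide (F.P K).L ν.M₂ (RkOfRecord (F.P K).L ν.r (g k)) k))),
      ∀ p ∈ plaqInside (cubeEnl (F.P K) (cubeSide (F.P K).L ν.M₂ (RkOfRecord (F.P K).L ν.r (g k)) k) c 1), ∀ b ∈ plaqBonds p,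
        b ∉ farBonds (Bj ν.M₁ (cubeEnl (F.P K) (cubeSide (F.P K).L ν.M₂ (RkOfRecord (F.P K).L ν.r (g k)) k) c 4) k))
    (fib : Finset (PBond (F.P K) k)) {D : ℕ → Set (Set (Site (F.P K) 0))} (s : Seq D k)
    (On : Finset ↥(cubeIndices (F.P K) (cubeSide (F.P K).L ν.M₂ (RkOfRecord (F.P K).L ν.r (g k)) k)))
    (hoff : ∀ c ∈ cubesIn (fun a : ↥(cubeIndices (F.P K) (cubeSide (F.P K).L ν.M₂ (RkOfRecord (F.P K).L ν.r (g k)) k)) =>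
        cubeEnl (F.P K) (cubeSide (F.P K).L ν.M₂ (RkOfRecord (F.P K).L ν.r (g k)) k) a 0) (s.Ω k), c ∉ On →
      ∀ x ∈ liftIter k (inputs (near (Bj ν.M₁ (cubeEnl (F.P K) (cubeSide (F.P K).L ν.M₂ (RkOfRecord (F.P K).L ν.r (g k)) k) c 4) k))), x ∉ fib)
    (pol : ↥(cubeIndices (F.P K) (cubeSide (F.P K).L ν.M₂ (RkOfRecord (F.P K).L ν.r (g k)) k)) → Pol)
    (S : ↥(cubeIndices (F.P K) (cubeSide (F.P K).L ν.M₂ (RkOfRecord (F.P K).L ν.r (g k)) k)) → ℝ) :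
    FibreIndep fib fun V : GaugeField (F.P K) k (SU N) =>
      ∏ c ∈ (cubesIn (fun a : ↥(cubeIndices (F.P K) (cubeSide (F.P K).L ν.M₂ (RkOfRecord (F.P K).L ν.r (g k)) k)) =>
          cubeEnl (F.P K) (cubeSide (F.P K).L ν.M₂ (RkOfRecord (F.P K).L ν.r (g k)) k) a 0) (s.Ω k)).filter (fun c => c ∉ On),
        (pol c).fac (smallInd (⨆ p : ↥(plaqInside (cubeEnl (F.P K) (cubeSide (F.P K).L ν.M₂ (RkOfRecord (F.P K).L ν.r (g k)) k) c 1)),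
          dist1 (GaugeField.plaqHol (ukBox (normalise (bgFamOfRecord F N ν K k) (plaqDetermined_plaqSmall _)) ν.M₁
            (cubeEnl (F.P K) (cubeSide (F.P K).L ν.M₂ (RkOfRecord (F.P K).L ν.r (g k)) k) c 4) k V) p.1)) (S c)) :=
  fibreIndep_prod_fac_smallInd fib _ pol
    (u := fun (c : ↥(cubeIndices (F.P K) (cubeSide (F.P K).L ν.M₂ (RkOfRecord (F.P K).L ν.r (g k)) k))) (V : GaugeField (F.P K) k (SU N)) =>
      ⨆ p : ↥(plaqInside (cubeEnl (F.P K) (cubeSide (F.P K).L ν.M₂ (RkOfRecord (F.P K).L ν.r (g k)) k) c 1)),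
        dist1 (GaugeField.plaqHol (ukBox (normalise (bgFamOfRecord F N ν K k) (plaqDetermined_plaqSmall _)) ν.M₁
          (cubeEnl (F.P K) (cubeSide (F.P K).L ν.M₂ (RkOfRecord (F.P K).L ν.r (g k)) k) c 4) k V) p.1))
    (fun c hc => fibreIndep_recordStatN F N ν g K k hk c (hgeom c) fib (hoff c (Finset.mem_filter.1 hc).1 (Finset.mem_filter.1 hc).2)) S

/-- (N3′) … in particular the OFF FACTOR of FILE 19's `chiSeqOfRecordBg F N 𝔟ᴺ …` itself (all polarities `small`, threshold `ε_kη_k²`).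
[cite: Balaban1988Convergent, (2.17)–(2.18) p.257] -/
theorem fibreIndep_chiSeqN_offFactor (ν : Stage7Numerics) (g : ℕ → ℝ) (K k : ℕ) [DecidableEq (PBond (F.P K) k)] (hk : k ≤ (F.P K).m + (F.P K).K)
    (hgeom : ∀ (c : ↥(cubeIndices (F.P K) (cubeSide (F.P K).L ν.M₂ (RkOfRecord (F.P K).L ν.r (g k)) k))),
      ∀ p ∈ plaqInside (cubeEnl (F.P K) (cubeSide (F.P K).L ν.M₂ (RkOfRecord (F.P K).L ν.r (g k)) k) c 1), ∀ b ∈ plaqBonds p,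
        b ∉ farBonds (Bj ν.M₁ (cubeEnl (F.P K) (cubeSide (F.P K).L ν.M₂ (RkOfRecord (F.P K).L ν.r (g k)) k) c 4) k))
    (fib : Finset (PBond (F.P K) k)) {D : ℕ → Set (Set (Site (F.P K) 0))} (s : Seq D k)
    (On : Finset ↥(cubeIndices (F.P K) (cubeSide (F.P K).L ν.M₂ (RkOfRecord (F.P K).L ν.r (g k)) k)))
    (hoff : ∀ c ∈ cubesIn (fun a : ↥(cubeIndices (F.P K) (cubeSide (F.P K).L ν.M₂ (RkOfRecord (F.P K).L ν.r (g k)) k)) =>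
        cubeEnl (F.P K) (cubeSide (F.P K).L ν.M₂ (RkOfRecord (F.P K).L ν.r (g k)) k) a 0) (s.Ω k), c ∉ On →
      ∀ x ∈ liftIter k (inputs (near (Bj ν.M₁ (cubeEnl (F.P K) (cubeSide (F.P K).L ν.M₂ (RkOfRecord (F.P K).L ν.r (g k)) k) c 4) k))), x ∉ fib) :
    FibreIndep fib fun V : GaugeField (F.P K) k (SU N) =>
      ∏ c ∈ (cubesIn (fun a : ↥(cubeIndices (F.P K) (cubeSide (F.P K).L ν.M₂ (RkOfRecord (F.P K).L ν.r (g k)) k)) =>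
          cubeEnl (F.P K) (cubeSide (F.P K).L ν.M₂ (RkOfRecord (F.P K).L ν.r (g k)) k) a 0) (s.Ω k)).filter (fun c => c ∉ On),
        smallInd (⨆ p : ↥(plaqInside (cubeEnl (F.P K) (cubeSide (F.P K).L ν.M₂ (RkOfRecord (F.P K).L ν.r (g k)) k) c 1)),
          dist1 (GaugeField.plaqHol (ukBox (normalise (bgFamOfRecord F N ν K k) (plaqDetermined_plaqSmall _)) ν.M₁
            (cubeEnl (F.P K) (cubeSide (F.P K).L ν.M₂ (RkOfRecord (F.P K).L ν.r (g k)) k) c 4) k V) p.1)) (epsOfRecord ν g k * (F.P K).eta k ^ 2) := by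
  have h := fibreIndep_chiSeqN_off F N ν g K k hk hgeom fib s On hoff (fun _ => Pol.small) (fun _ => epsOfRecord ν g k * (F.P K).eta k ^ 2)
  simpa only [Pol.fac_small] using h

/-! ## (N4) The identification with the record's RAW χ: equal on solvable cubes under plaquette-uniqueness, dominated everywhere -/

/-- (N4-a) On a cube whose (2.16) datum is SOLVABLE, under plaquette-uniqueness on its tested plaquettes, the χ-slot at `𝔟ᴺ` EQUALS the record's raw χ-slot
(both backgrounds are (2.12) minimisers for the same datum). [cite: Balaban1988Convergent, (2.12) p.256, (2.16)–(2.17) p.257] -/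
theorem chiSlotN_eq_chiSlot_of_solvable_of_huniq (ν : Stage7Numerics) (g : ℕ → ℝ) (K k : ℕ)
    (a : ↥(cubeIndices (F.P K) (cubeSide (F.P K).L ν.M₂ (RkOfRecord (F.P K).L ν.r (g k)) k))) {V : GaugeField (F.P K) k (SU N)}
    (hsol : ∃ U₀, IsMinimizer (avOfRecord F N K) {U | PlaqSmall (ν.εreg * (F.P K).eta k ^ 2) U}
      (Bj ν.M₁ (cubeEnl (F.P K) (cubeSide (F.P K).L ν.M₂ (RkOfRecord (F.P K).L ν.r (g k)) k) a 4) k) (avgFamily (avOfRecord F N K) (qsstarGIter0 k V)) U₀)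
    (huniq : ∀ (X : MSField (F.P K) (SU N)) (U₀ U₁ : GaugeField (F.P K) 0 (SU N)),
      IsMinimizer (avOfRecord F N K) {U | PlaqSmall (ν.εreg * (F.P K).eta k ^ 2) U}
        (Bj ν.M₁ (cubeEnl (F.P K) (cubeSide (F.P K).L ν.M₂ (RkOfRecord (F.P K).L ν.r (g k)) k) a 4) k) X U₀ →
      IsMinimizer (avOfRecord F N K) {U | PlaqSmall (ν.εreg * (F.P K).eta k ^ 2) U}
        (Bj ν.M₁ (cubeEnl (F.P K) (cubeSide (F.P K).L ν.M₂ (RkOfRecord (F.P K).L ν.r (g k)) k) a 4) k) X U₁ →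
      ∀ p ∈ plaqInside (cubeEnl (F.P K) (cubeSide (F.P K).L ν.M₂ (RkOfRecord (F.P K).L ν.r (g k)) k) a 1),
        dist1 (GaugeField.plaqHol U₀ p) = dist1 (GaugeField.plaqHol U₁ p))
    {θ : ℝ} (hθ : 0 < θ) :
    chiSmall (plaqInside (cubeEnl (F.P K) (cubeSide (F.P K).L ν.M₂ (RkOfRecord (F.P K).L ν.r (g k)) k) a 1)) θ
        (ukBox (normalise (bgFamOfRecord F N ν K k) (plaqDetermined_plaqSmall _)) ν.M₁
          (cubeEnl (F.P K) (cubeSide (F.P K).L ν.M₂ (RkOfRecord (F.P K).L ν.r (g k)) k) a 4) k V)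
      = chiSmall (plaqInside (cubeEnl (F.P K) (cubeSide (F.P K).L ν.M₂ (RkOfRecord (F.P K).L ν.r (g k)) k) a 1)) θ
        (ukBox (bgFamOfRecord F N ν K k) ν.M₁ (cubeEnl (F.P K) (cubeSide (F.P K).L ν.M₂ (RkOfRecord (F.P K).L ν.r (g k)) k) a 4) k V) := by
  rw [chiSmall_eq_smallInd_iSup (Or.inr hθ), chiSmall_eq_smallInd_iSup (Or.inr hθ)]
  refine congrArg (smallInd · θ) (iSup_congr fun p => ?_)
  exact huniq _ _ _
    (isMinimizer_normalise (bgFamOfRecord F N ν K k) (plaqDetermined_plaqSmall _)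
      (Bj ν.M₁ (cubeEnl (F.P K) (cubeSide (F.P K).L ν.M₂ (RkOfRecord (F.P K).L ν.r (g k)) k) a 4) k) hsol)
    (isMinimizer_ukBox_of_solvable hsol) p.1 p.2

/-- (N4-b) **THE χ-SLOT AT `𝔟ᴺ` IS DOMINATED BY THE RECORD's RAW χ-SLOT** under plaquette-uniqueness: equal on a solvable cube (N4-a), and on an
unsolvable cube the record's slot is junk-`1` (n20-d `chiSmall_ukBox_eq_one_of_not_solvable`; file 26: every far-large configuration).
[cite: Balaban1988Convergent, (2.12) p.256, (2.17) p.257 (typing convention)] -/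
theorem chiSlotN_le_chiSlot_of_huniq (ν : Stage7Numerics) (g : ℕ → ℝ) (K k : ℕ)
    (a : ↥(cubeIndices (F.P K) (cubeSide (F.P K).L ν.M₂ (RkOfRecord (F.P K).L ν.r (g k)) k))) (V : GaugeField (F.P K) k (SU N))
    (huniq : ∀ (X : MSField (F.P K) (SU N)) (U₀ U₁ : GaugeField (F.P K) 0 (SU N)),
      IsMinimizer (avOfRecord F N K) {U | PlaqSmall (ν.εreg * (F.P K).eta k ^ 2) U}
        (Bj ν.M₁ (cubeEnl (F.P K) (cubeSide (F.P K).L ν.M₂ (RkOfRecord (F.P K).L ν.r (g k)) k) a 4) k) X U₀ →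
      IsMinimizer (avOfRecord F N K) {U | PlaqSmall (ν.εreg * (F.P K).eta k ^ 2) U}
        (Bj ν.M₁ (cubeEnl (F.P K) (cubeSide (F.P K).L ν.M₂ (RkOfRecord (F.P K).L ν.r (g k)) k) a 4) k) X U₁ →
      ∀ p ∈ plaqInside (cubeEnl (F.P K) (cubeSide (F.P K).L ν.M₂ (RkOfRecord (F.P K).L ν.r (g k)) k) a 1),
        dist1 (GaugeField.plaqHol U₀ p) = dist1 (GaugeField.plaqHol U₁ p))
    {θ : ℝ} (hθ : 0 < θ) :
    chiSmall (plaqInside (cubeEnl (F.P K) (cubeSide (F.P K).L ν.M₂ (RkOfRecord (F.P K).L ν.r (g k)) k) a 1)) θ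
        (ukBox (normalise (bgFamOfRecord F N ν K k) (plaqDetermined_plaqSmall _)) ν.M₁
          (cubeEnl (F.P K) (cubeSide (F.P K).L ν.M₂ (RkOfRecord (F.P K).L ν.r (g k)) k) a 4) k V)
      ≤ chiSmall (plaqInside (cubeEnl (F.P K) (cubeSide (F.P K).L ν.M₂ (RkOfRecord (F.P K).L ν.r (g k)) k) a 1)) θ
        (ukBox (bgFamOfRecord F N ν K k) ν.M₁ (cubeEnl (F.P K) (cubeSide (F.P K).L ν.M₂ (RkOfRecord (F.P K).L ν.r (g k)) k) a 4) k V) := by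
  by_cases hsol : ∃ U₀, IsMinimizer (avOfRecord F N K) {U | PlaqSmall (ν.εreg * (F.P K).eta k ^ 2) U}
      (Bj ν.M₁ (cubeEnl (F.P K) (cubeSide (F.P K).L ν.M₂ (RkOfRecord (F.P K).L ν.r (g k)) k) a 4) k) (avgFamily (avOfRecord F N K) (qsstarGIter0 k V)) U₀
  · exact (chiSlotN_eq_chiSlot_of_solvable_of_huniq F N ν g K k a hsol huniq hθ).le
  · have h1 : chiSmall (plaqInside (cubeEnl (F.P K) (cubeSide (F.P K).L ν.M₂ (RkOfRecord (F.P K).L ν.r (g k)) k) a 1)) θ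
        (ukBox (bgFamOfRecord F N ν K k) ν.M₁ (cubeEnl (F.P K) (cubeSide (F.P K).L ν.M₂ (RkOfRecord (F.P K).L ν.r (g k)) k) a 4) k V) = 1 :=
      chiSmall_ukBox_eq_one_of_not_solvable _ hθ hsol
    rw [h1]
    exact chiSmall_le_one _ _ _

/-- ★ (N4-c) **`χᴺ_k(Ω_k) ≤ χ_k(Ω_k)` OF RECORD, pointwise, under plaquette-uniqueness on every cube of `Ω_k(s)`** — FILE 19's sequence χ over `𝔟ᴺ` is
dominated by FILE 4's `chiSeqOfRecord` (`Finset.prod_le_prod`, factors in `[0, 1]`); equality where every cube of `Ω_k(s)` is solvable.  The bridge def-R g18 §D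
names: `huniq` near + NOTHING far. [cite: Balaban1988Convergent, (2.12) p.256, (2.17)–(2.18) p.257 (typing convention)] -/
theorem chiSeqN_le_chiSeqOfRecord_of_huniq (ν : Stage7Numerics) (M : ℕ) (g : ℕ → ℝ) (K k : ℕ)
    (hε : 0 < epsOfRecord ν g k * (F.P K).eta k ^ 2) (s : SeqOfRecord F ν M g K k) (V : GaugeField (F.P K) k (SU N))
    (huniq : ∀ (a : ↥(cubeIndices (F.P K) (cubeSide (F.P K).L ν.M₂ (RkOfRecord (F.P K).L ν.r (g k)) k))) (X : MSField (F.P K) (SU N))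
      (U₀ U₁ : GaugeField (F.P K) 0 (SU N)),
      IsMinimizer (avOfRecord F N K) {U | PlaqSmall (ν.εreg * (F.P K).eta k ^ 2) U}
        (Bj ν.M₁ (cubeEnl (F.P K) (cubeSide (F.P K).L ν.M₂ (RkOfRecord (F.P K).L ν.r (g k)) k) a 4) k) X U₀ →
      IsMinimizer (avOfRecord F N K) {U | PlaqSmall (ν.εreg * (F.P K).eta k ^ 2) U}
        (Bj ν.M₁ (cubeEnl (F.P K) (cubeSide (F.P K).L ν.M₂ (RkOfRecord (F.P K).L ν.r (g k)) k) a 4) k) X U₁ →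
      ∀ p ∈ plaqInside (cubeEnl (F.P K) (cubeSide (F.P K).L ν.M₂ (RkOfRecord (F.P K).L ν.r (g k)) k) a 1),
        dist1 (GaugeField.plaqHol U₀ p) = dist1 (GaugeField.plaqHol U₁ p)) :
    chiSeqOfRecordBg F N (fun K k => normalise (bgFamOfRecord F N ν K k) (plaqDetermined_plaqSmall _)) ν M g K k s V
      ≤ chiSeqOfRecord F N ν M g K k s V := by
  rw [← chiSeqOfRecordBg_bgFam, chiSeqOfRecordBg_apply, chiSeqOfRecordBg_apply]
  exact Finset.prod_le_prod (fun a _ => chiSmall_nonneg _ _ _) fun a _ => chiSlotN_le_chiSlot_of_huniq F N ν g K k a V (huniq a) hε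

end Summit.QuantumFields.YangMills.Theorems.N21ThresholdMixtureRStepLocalityBgN

end
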